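import Summits.BirchSwinnertonDyer.Rank1Residual.Additive.GreenbergVatsalTransferCountThree
import Summits.BirchSwinnertonDyer.Rank1Residual.Additive.RamifiedOrdinaryLineQuotientInvariantsModelFree
import HarnessLib

/-!
# GV's two-curve count at the A240 datum: `#(S^{S₀}_{E₁[p^∞]}(ℚ_∞)[p]) = #(S^{S₀}_{E₂[p^∞]}(ℚ_∞)[p])`
# for ramified ordinary lines, `p ∤ #Eᵢ(ℚ)_tors`, and `E₁[p] ≃ E₂[p]` carrying `C₁[p]` onto `C₂[p]`
# (cell `b2b-bsdres`, team n1011, seat p06 GEN 5; OWNERS row T-A240-PORT, FILE 1 — lead GEN 7 R5-65 (f))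

HONEST FRAMING (cell `b2b-bsdres`, run/shared/lean/b2b/bsd-rank1-residual/, verbatim in every
file): the goal of the cell is to DELETE the COMBINATION-SHAPED residual classes of the
Birch–Swinnerton-Dyer formula for ALL analytic-rank `≤ 1` elliptic curves over `ℚ` — "full BSD
formula for every rank `≤ 1` curve in class `C`" assembled STRICTLY from published theorems — so
that the rank-`≤ 1` remainder becomes exactly the CONSTRUCTION-SHAPED classes, which are TYPED
(missing-input `Prop`s), NOT attempted. This is not "finishing BSD". Team n1011 (N10/N11: X4 ∧
`p = 3`; X3♯): research routes on CONSTRUCTION-SHAPED classes (ARM α of ROUTE-2); census output =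
EVIDENCE, never a Literature fact; RESIDUAL-MAP marks UNCHANGED; nothing is booked by this file.
THEOREMS ONLY: no definition, no named fact; p12's `GreenbergVatsalTorsionRamifiedQuotient` /
`GreenbergVatsalTransferRamifiedQuotient` / `GreenbergVatsalTransferCountThree`, eisenstein-p2's
`X2/…` files and cc-typer-2's fact A240 are consumed BY NAME and untouched.

## What and why (row T-A240-PORT = the PORT half of the discharge of A240 =
## `GreenbergVatsal2000.muLambdaAlg_transfer_of_torsionIso_potOrd_of_not_dvd_torsionOrder`)

FINDING recorded with the row: the PORT of `X2/GreenbergVatsalTorsionIso.natCard_gvSelmer_inf_torsion_mul_eq`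
from "`I_p` acts trivially on `D`" to "`H⁰(I_𝔭, D)` `n`-divisible" IS p12's
`GreenbergVatsalTransferRamified.natCard_gvSelmer_inf_torsion_mul_eq_of_divisible_invariants`
(row T-E3g-GV29 FILE 2). THIS FILE instantiates it at the datum of A240 (steps (1)+(2) of the fact's
"composed argument": GV Prop. (2.8) + Remark (2.9) + pp. 26–27 "`Sel^{Σ₀}_{Eᵢ}(ℚ_∞)[p] ≅
S^{Σ₀}_{Aᵢ[p]}(ℚ_∞)` … the order of this group is independent of `i`"):

* `natCard_gvSelmerInfty_inf_torsion_eq_of_isRamifiedOrdinaryLine` — for `E₁, E₂/ℚ`, a prime `p`, ANY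
  `ℤ_p`-extension `κ` of `ℚ`, Greenberg data `L₁, L₂` at the places above `p` all of whose members
  are RAMIFIED ORDINARY LINES (`EmertonPollackWeston2006.IsRamifiedOrdinaryLine`), `p ∤ #Eᵢ(ℚ)_tors`
  (so `H⁰ = Eᵢ(ℚ_∞)[p^∞][p] = 0`, p12 `natCard_torsionBy_fixedPoints_eq_one`, `Gal(ℚ_∞/ℚ)` pro-`p`),
  `S₀` containing the bad places `≠ p` of both, a `Γ_ℚ`-isomorphism `θ : E₁[p^∞][p] ≃ E₂[p^∞][p]`
  carrying `E₁[p] ∩ C₁` onto `E₂[p] ∩ C₂`, and ONE displayed local binder per curve,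
  **`h0ᵢ : (Eᵢ[p^∞]/Cᵢ)^{ker κ ⊓ I_v} = 0`** (Remark (2.9)'s case; FILE 2 of this row discharges it
  from `IsRamifiedOrdinaryLine`; p12's `RamifiedOrdinaryLineQuotientInvariants` already discharges it
  for the cell's transported data on X4♯/X3♯(G-ord, e = 2) and the (M) rows):
  **`#(S^{S₀}_{E₁[p^∞]}(ℚ_∞) ⊓ H¹[p]) = #(S^{S₀}_{E₂[p^∞]}(ℚ_∞) ⊓ H¹[p])`**;
* `exists_torsionBy_equiv_map_plus_eq` — the adapter from A240's own isomorphism currency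
  (`e : E₁[p] ≃+ E₂[p]` on `geomTorsion`, `Γ_ℚ`-equivariant, with
  `P ∈ C₁ ↔ e P ∈ C₂` through `AddSubgroup.inclusion (geomTorsion_le_geomPrimaryTorsion _ p)`) to
  the `(θ, hθ, hθL)` currency of the kernel transfer (eisenstein-p2's
  `nonempty_torsionBy_primaryTorsion_equiv` pattern);
* `natCard_gvSelmerInfty_inf_torsion_eq_of_isRamifiedOrdinaryLine_of_torsionIso` — the two combined:
  the count equality from A240's binders `hLᵢ`, `htorsᵢ`, `hSᵢ`, `(e, he, heL)` plus `h0ᵢ`.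

NOT here: the `_holds` of A240 (partner row T-A240-K, p07: Cor. (2.3) / Prop. (2.4) / (2.5) /
Greenberg 4.14 steps (3)–(5)); the Kummer identification `hRDᵢ` (ARM δ); any claim about a class.

References: R. Greenberg, V. Vatsal, Invent. Math. 142 (2000) §2 Prop. (2.8) (arXiv p. 25), Remark
(2.9) (p. 26), pp. 26–27 [GreenbergVatsal2000]; R. Greenberg, LNM 1716 §3 Lemma 3.1 / proof of
Prop. 4.14 ("`Γ` is pro-`p`") [GreenbergLNM1716]; M. Emerton, R. Pollack, T. Weston (2006) §3.1
(eq:ordes) [EmertonPollackWeston2006].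
-/

set_option autoImplicit false

noncomputable section

open scoped Classical AddSubgroup

open NumberField IsDedekindDomain Field
open Literature.NumberTheory.EllipticCurves Literature.NumberTheory.EllipticCurves.GreenbergSelmer
  Literature.NumberTheory.EllipticCurves.EmertonPollackWeston2006
  Literature.NumberTheory.GaloisRepresentations
  Summit.BirchSwinnertonDyer.Rank1Residual.X2.TorsionComparison
  Summit.BirchSwinnertonDyer.Rank1Residual.X2.GreenbergVatsalTorsion

namespace Summit.BirchSwinnertonDyer.Rank1Residual.Additive

variable {p : ℕ} [hp : Fact p.Prime] (W₁ W₂ : WeierstrassCurve ℚ) [W₁.IsElliptic] [W₂.IsElliptic]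
  (κ : ZpExtension ℚ p) (L₁ : Data ℚ (W₁.geomPrimaryTorsion p) p)
  (L₂ : Data ℚ (W₂.geomPrimaryTorsion p) p) (S₀ : Set (HeightOneSpectrum (𝓞 ℚ)))

/-- **GV's two-curve count at ramified ordinary lines (Remark (2.9) form), `p ∤ #Eᵢ(ℚ)_tors`, with
the ONE local binder `h0ᵢ : (Eᵢ[p^∞]/Cᵢ)^{ker κ ⊓ I_v} = 0` displayed.** For `E₁, E₂/ℚ`, any
`ℤ_p`-extension `κ` (`H = ker κ`, `L = ℚ_∞^κ`), Greenberg data of ramified ordinary lines at the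
places above `p`, `S₀ ⊇` the bad places `≠ p` of both, and a `Γ_ℚ`-isomorphism
`θ : E₁[p^∞][p] ≃ E₂[p^∞][p]` carrying `E₁[p] ∩ C₁` onto `E₂[p] ∩ C₂`:
`#(S^{S₀}_{E₁[p^∞]}(L) ⊓ H¹[p]) = #(S^{S₀}_{E₂[p^∞]}(L) ⊓ H¹[p])` — GV pp. 26–27 "by proposition
(2.8), `Sel^{Σ₀}_{Eᵢ}(ℚ_∞)[p] = S^{Σ₀}_{Aᵢ}(ℚ_∞)[p] ≅ S^{Σ₀}_{Aᵢ[p]}(ℚ_∞)` … the order of this group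
is independent of `i`", the `H⁰`-terms being `1` because `Eᵢ(ℚ)[p] = 0` and `Γ` is pro-`p`.
(p12's `natCard_gvSelmer_inf_torsion_mul_eq_of_divisible_invariants` + `divisible_invariants_of_invariants_eq_bot`
+ eisenstein-p2's curve inputs + `natCard_torsionBy_fixedPoints_eq_one`.)
[cite: GreenbergVatsal2000, §2 Prop. (2.8) (p. 25), Remark (2.9) (p. 26) and pp. 26–27]
[cite: GreenbergLNM1716, §3 Lemma 3.1 (p. 86)] -/
theorem natCard_gvSelmerInfty_inf_torsion_eq_of_isRamifiedOrdinaryLine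
    (hL₁ : ∀ v hv, IsRamifiedOrdinaryLine W₁ p (L₁ v hv))
    (hL₂ : ∀ v hv, IsRamifiedOrdinaryLine W₂ p (L₂ v hv))
    (htors₁ : ¬ p ∣ W₁.torsionOrder) (htors₂ : ¬ p ∣ W₂.torsionOrder)
    (hS₁ : ∀ v : HeightOneSpectrum (𝓞 ℚ), v ∉ S₀ → ((p : ℕ) : 𝓞 ℚ) ∉ v.asIdeal →
      W₁.HasGoodReductionAt v)
    (hS₂ : ∀ v : HeightOneSpectrum (𝓞 ℚ), v ∉ S₀ → ((p : ℕ) : 𝓞 ℚ) ∉ v.asIdeal →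
      W₂.HasGoodReductionAt v)
    (h0₁ : ∀ (v : HeightOneSpectrum (𝓞 ℚ)) (hv : ((p : ℕ) : 𝓞 ℚ) ∈ v.asIdeal),
      ∀ a ∈ invariants (inertiaIn κ.kerSubgroup v) (L₁ v hv).Gr, a = 0)
    (h0₂ : ∀ (v : HeightOneSpectrum (𝓞 ℚ)) (hv : ((p : ℕ) : 𝓞 ℚ) ∈ v.asIdeal),
      ∀ a ∈ invariants (inertiaIn κ.kerSubgroup v) (L₂ v hv).Gr, a = 0)
    (θ : (W₁.geomPrimaryTorsion p)[(p : ℤ)] ≃+ (W₂.geomPrimaryTorsion p)[(p : ℤ)])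
    (hθ : ∀ (g : absoluteGaloisGroup ℚ) (m : (W₁.geomPrimaryTorsion p)[(p : ℤ)]), θ (g • m) = g • θ m)
    (hθL : ∀ (v : HeightOneSpectrum (𝓞 ℚ)) (hv : ((p : ℕ) : 𝓞 ℚ) ∈ v.asIdeal),
      (torsionData L₁ p v hv).plus.map
          (θ : (W₁.geomPrimaryTorsion p)[(p : ℤ)] →+ (W₂.geomPrimaryTorsion p)[(p : ℤ)]) =
        (torsionData L₂ p v hv).plus) :
    Nat.card (gvSelmerInfty κ (W₁.geomPrimaryTorsion p) L₁ S₀ ⊓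
        (subgroupH1 κ.kerSubgroup (W₁.geomPrimaryTorsion p))[(p : ℤ)] :
        AddSubgroup (subgroupH1 κ.kerSubgroup (W₁.geomPrimaryTorsion p))) =
      Nat.card (gvSelmerInfty κ (W₂.geomPrimaryTorsion p) L₂ S₀ ⊓
        (subgroupH1 κ.kerSubgroup (W₂.geomPrimaryTorsion p))[(p : ℤ)] :
        AddSubgroup (subgroupH1 κ.kerSubgroup (W₂.geomPrimaryTorsion p))) := by
  haveI : Finite (invariants κ.kerSubgroup (W₁.geomPrimaryTorsion p)) :=
    finite_fixedPoints_of_not_dvd_torsionOrder W₁ κ htors₁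
  haveI : Finite (invariants κ.kerSubgroup (W₂.geomPrimaryTorsion p)) :=
    finite_fixedPoints_of_not_dvd_torsionOrder W₂ κ htors₂
  have h := GreenbergVatsalTransferRamified.natCard_gvSelmer_inf_torsion_mul_eq_of_divisible_invariants
    κ.kerSubgroup (W₁.geomPrimaryTorsion p) (W₂.geomPrimaryTorsion p) p L₁ L₂ S₀ p
    (X2.GreenbergVatsalTorsionCurve.continuous_smul_curve W₁ p)
    (X2.GreenbergVatsalTorsionCurve.continuous_smul_curve W₂ p)
    (X2.GreenbergVatsalTorsionCurve.divisible_curve W₁ p)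
    (X2.GreenbergVatsalTorsionCurve.divisible_curve W₂ p)
    (X2.GreenbergVatsalTorsionCurve.unramified_outside W₁ p S₀ hS₁)
    (X2.GreenbergVatsalTorsionCurve.unramified_outside W₂ p S₀ hS₂)
    (fun v hv ↦ fun _ hm ↦ (hL₁ v hv).divisible hm) (fun v hv ↦ fun _ hm ↦ (hL₂ v hv).divisible hm)
    (fun v hv ↦ GreenbergVatsalTorsionRamified.divisible_invariants_of_invariants_eq_bot
      κ.kerSubgroup (W₁.geomPrimaryTorsion p) p (L₁ v hv) (h0₁ v hv))
    (fun v hv ↦ GreenbergVatsalTorsionRamified.divisible_invariants_of_invariants_eq_bot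
      κ.kerSubgroup (W₂.geomPrimaryTorsion p) p (L₂ v hv) (h0₂ v hv))
    θ hθ hθL
  have e₁ : Nat.card ((invariants κ.kerSubgroup (W₁.geomPrimaryTorsion p))[(p : ℤ)]) = 1 :=
    natCard_torsionBy_fixedPoints_eq_one W₁ κ htors₁
  have e₂ : Nat.card ((invariants κ.kerSubgroup (W₂.geomPrimaryTorsion p))[(p : ℤ)]) = 1 :=
    natCard_torsionBy_fixedPoints_eq_one W₂ κ htors₂
  rw [e₁, e₂, mul_one, mul_one] at h
  exact h

omit [W₁.IsElliptic] [W₂.IsElliptic] in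
/-- **Adapter: from A240's isomorphism currency to the kernel transfer's.** A `Γ_ℚ`-equivariant
`e : E₁[p] ≃+ E₂[p]` (on `geomTorsion`) with `P ∈ C₁ ↔ e P ∈ C₂` (through the inclusions
`E_i[p] ↪ E_i[p^∞]`) at every place above `p` yields a `Γ_ℚ`-equivariant
`θ : E₁[p^∞][p] ≃+ E₂[p^∞][p]` carrying `E₁[p] ∩ C₁` onto `E₂[p] ∩ C₂` (same points; eisenstein-p2's
`nonempty_torsionBy_primaryTorsion_equiv`). [folklore] -/
theorem exists_torsionBy_equiv_map_plus_eq (e : W₁.geomTorsion (p : ℤ) ≃+ W₂.geomTorsion (p : ℤ))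
    (he : ∀ (σ : absoluteGaloisGroup ℚ) (P : W₁.geomTorsion (p : ℤ)), e (σ • P) = σ • e P)
    (heL : ∀ (v : HeightOneSpectrum (𝓞 ℚ)) (hv : ((p : ℕ) : 𝓞 ℚ) ∈ v.asIdeal),
      ∀ P : W₁.geomTorsion (p : ℤ),
        AddSubgroup.inclusion (W₁.geomTorsion_le_geomPrimaryTorsion p) P ∈ (L₁ v hv).plus ↔
          AddSubgroup.inclusion (W₂.geomTorsion_le_geomPrimaryTorsion p) (e P) ∈ (L₂ v hv).plus) :
    ∃ θ : (W₁.geomPrimaryTorsion p)[(p : ℤ)] ≃+ (W₂.geomPrimaryTorsion p)[(p : ℤ)],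
      (∀ (g : absoluteGaloisGroup ℚ) (m : (W₁.geomPrimaryTorsion p)[(p : ℤ)]), θ (g • m) = g • θ m) ∧
      ∀ (v : HeightOneSpectrum (𝓞 ℚ)) (hv : ((p : ℕ) : 𝓞 ℚ) ∈ v.asIdeal),
        (torsionData L₁ p v hv).plus.map
            (θ : (W₁.geomPrimaryTorsion p)[(p : ℤ)] →+ (W₂.geomPrimaryTorsion p)[(p : ℤ)]) =
          (torsionData L₂ p v hv).plus := by
  obtain ⟨j₁, hj₁, hj₁'⟩ := X2.GreenbergVatsalTransferCurve.nonempty_torsionBy_primaryTorsion_equiv W₁ p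
  obtain ⟨j₂, hj₂, hj₂'⟩ := X2.GreenbergVatsalTransferCurve.nonempty_torsionBy_primaryTorsion_equiv W₂ p
  -- equivariance of `j₂⁻¹` and of `θ = j₂⁻¹ ∘ e ∘ j₁` (as in eisenstein-p2's `exists_equiv_of_torsionIso`)
  have hj₂s : ∀ (g : absoluteGaloisGroup ℚ) (y : W₂.geomTorsion (p : ℤ)),
      j₂.symm (g • y) = g • j₂.symm y := by
    intro g y
    apply j₂.injective
    rw [j₂.apply_symm_apply]
    apply Subtype.ext
    rw [hj₂ g (j₂.symm y), j₂.apply_symm_apply]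
    rfl
  refine ⟨j₁.trans (e.trans j₂.symm), fun g m ↦ ?_, fun v hv ↦ ?_⟩
  · have hj₁g : j₁ (g • m) = g • j₁ m := Subtype.ext (hj₁ g m)
    rw [AddEquiv.trans_apply, AddEquiv.trans_apply, AddEquiv.trans_apply, AddEquiv.trans_apply, hj₁g,
      he, hj₂s]
  · -- the underlying points: `(j₁ x : E) = (x : E)` and `(j₂⁻¹ y : E) = (y : E)`
    have hpt₁ : ∀ x : (W₁.geomPrimaryTorsion p)[(p : ℤ)],
        AddSubgroup.inclusion (W₁.geomTorsion_le_geomPrimaryTorsion p) (j₁ x) =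
          (x : W₁.geomPrimaryTorsion p) := fun x ↦ by
      apply Subtype.ext
      have h := hj₁' (j₁ x)
      rw [j₁.symm_apply_apply] at h
      exact h.symm
    have hpt₂ : ∀ y : W₂.geomTorsion (p : ℤ),
        ((j₂.symm y : (W₂.geomPrimaryTorsion p)[(p : ℤ)]) : W₂.geomPrimaryTorsion p) =
          AddSubgroup.inclusion (W₂.geomTorsion_le_geomPrimaryTorsion p) y := fun y ↦
      Subtype.ext (hj₂' y)
    -- membership correspondence
    have hmem : ∀ x : (W₁.geomPrimaryTorsion p)[(p : ℤ)],
        x ∈ (torsionData L₁ p v hv).plus ↔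
          (j₁.trans (e.trans j₂.symm)) x ∈ (torsionData L₂ p v hv).plus := by
      intro x
      change x ∈ (torsionDatum (L₁ v hv) p).plus ↔ _ ∈ (torsionDatum (L₂ v hv) p).plus
      rw [torsionDatum, torsionDatum, AddSubgroup.mem_addSubgroupOf, AddSubgroup.mem_addSubgroupOf,
        ← hpt₁ x, heL v hv (j₁ x), AddEquiv.trans_apply, AddEquiv.trans_apply, hpt₂]
    ext y
    rw [AddSubgroup.mem_map]
    constructor
    · rintro ⟨x, hx, rfl⟩
      exact (hmem x).mp hx
    · intro hy
      refine ⟨(j₁.trans (e.trans j₂.symm)).symm y, ?_, by simp⟩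
      rw [hmem, AddEquiv.apply_symm_apply]
      exact hy

/-- **The count equality in A240's own currency** (`e : E₁[p] ≃+ E₂[p]` equivariant with the line
clause, `IsRamifiedOrdinaryLine` data, `p ∤ #Eᵢ(ℚ)_tors`, `S₀`), modulo the one local binder `h0ᵢ`.
[cite: GreenbergVatsal2000, §2 Prop. (2.8) (p. 25), Remark (2.9) (p. 26) and pp. 26–27] -/
theorem natCard_gvSelmerInfty_inf_torsion_eq_of_isRamifiedOrdinaryLine_of_torsionIso
    (hL₁ : ∀ v hv, IsRamifiedOrdinaryLine W₁ p (L₁ v hv))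
    (hL₂ : ∀ v hv, IsRamifiedOrdinaryLine W₂ p (L₂ v hv))
    (htors₁ : ¬ p ∣ W₁.torsionOrder) (htors₂ : ¬ p ∣ W₂.torsionOrder)
    (hS₁ : ∀ v : HeightOneSpectrum (𝓞 ℚ), v ∉ S₀ → ((p : ℕ) : 𝓞 ℚ) ∉ v.asIdeal →
      W₁.HasGoodReductionAt v)
    (hS₂ : ∀ v : HeightOneSpectrum (𝓞 ℚ), v ∉ S₀ → ((p : ℕ) : 𝓞 ℚ) ∉ v.asIdeal →
      W₂.HasGoodReductionAt v)
    (h0₁ : ∀ (v : HeightOneSpectrum (𝓞 ℚ)) (hv : ((p : ℕ) : 𝓞 ℚ) ∈ v.asIdeal),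
      ∀ a ∈ invariants (inertiaIn κ.kerSubgroup v) (L₁ v hv).Gr, a = 0)
    (h0₂ : ∀ (v : HeightOneSpectrum (𝓞 ℚ)) (hv : ((p : ℕ) : 𝓞 ℚ) ∈ v.asIdeal),
      ∀ a ∈ invariants (inertiaIn κ.kerSubgroup v) (L₂ v hv).Gr, a = 0)
    (e : W₁.geomTorsion (p : ℤ) ≃+ W₂.geomTorsion (p : ℤ))
    (he : ∀ (σ : absoluteGaloisGroup ℚ) (P : W₁.geomTorsion (p : ℤ)), e (σ • P) = σ • e P)
    (heL : ∀ (v : HeightOneSpectrum (𝓞 ℚ)) (hv : ((p : ℕ) : 𝓞 ℚ) ∈ v.asIdeal),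
      ∀ P : W₁.geomTorsion (p : ℤ),
        AddSubgroup.inclusion (W₁.geomTorsion_le_geomPrimaryTorsion p) P ∈ (L₁ v hv).plus ↔
          AddSubgroup.inclusion (W₂.geomTorsion_le_geomPrimaryTorsion p) (e P) ∈ (L₂ v hv).plus) :
    Nat.card (gvSelmerInfty κ (W₁.geomPrimaryTorsion p) L₁ S₀ ⊓
        (subgroupH1 κ.kerSubgroup (W₁.geomPrimaryTorsion p))[(p : ℤ)] :
        AddSubgroup (subgroupH1 κ.kerSubgroup (W₁.geomPrimaryTorsion p))) =
      Nat.card (gvSelmerInfty κ (W₂.geomPrimaryTorsion p) L₂ S₀ ⊓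
        (subgroupH1 κ.kerSubgroup (W₂.geomPrimaryTorsion p))[(p : ℤ)] :
        AddSubgroup (subgroupH1 κ.kerSubgroup (W₂.geomPrimaryTorsion p))) := by
  obtain ⟨θ, hθ, hθL⟩ := exists_torsionBy_equiv_map_plus_eq W₁ W₂ L₁ L₂ e he heL
  exact natCard_gvSelmerInfty_inf_torsion_eq_of_isRamifiedOrdinaryLine W₁ W₂ κ L₁ L₂ S₀ hL₁ hL₂
    htors₁ htors₂ hS₁ hS₂ h0₁ h0₂ θ hθ hθL

/-- **The binder-free PORT at A240's datum (`p ≠ 2`)** — FILE 3 of the row: the local binder `h0ᵢ`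
(`(E[p^∞]/C_v)^{ker κ ⊓ I_v} = 0`, GV Remark (2.9)) is DISCHARGED on every ramified ordinary line by
seat p12's model-free `RamifiedOrdinaryLineQuotientModelFree.data_gr_invariants_eq_zero_of_
isRamifiedOrdinaryLine` (consumed BY NAME), so the hypotheses are now A240's own:
`IsRamifiedOrdinaryLine ×2`, `p ∤ #Eᵢ(ℚ)_tors ×2`, good reduction outside `S₀ ∪ {p}` ×2, and the
equivariant `e : E₁[p] ≃+ E₂[p]` with its line clause — NO `hRD`, NO `Λ`-module input.
[cite: GreenbergVatsal2000, §2 Prop. (2.8) (p. 25), Remark (2.9) (p. 26) and pp. 26–27] -/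
theorem natCard_gvSelmerInfty_inf_torsion_eq_of_isRamifiedOrdinaryLine_of_torsionIso_of_ne_two
    (hp2 : p ≠ 2)
    (hL₁ : ∀ v hv, IsRamifiedOrdinaryLine W₁ p (L₁ v hv))
    (hL₂ : ∀ v hv, IsRamifiedOrdinaryLine W₂ p (L₂ v hv))
    (htors₁ : ¬ p ∣ W₁.torsionOrder) (htors₂ : ¬ p ∣ W₂.torsionOrder)
    (hS₁ : ∀ v : HeightOneSpectrum (𝓞 ℚ), v ∉ S₀ → ((p : ℕ) : 𝓞 ℚ) ∉ v.asIdeal →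
      W₁.HasGoodReductionAt v)
    (hS₂ : ∀ v : HeightOneSpectrum (𝓞 ℚ), v ∉ S₀ → ((p : ℕ) : 𝓞 ℚ) ∉ v.asIdeal →
      W₂.HasGoodReductionAt v)
    (e : W₁.geomTorsion (p : ℤ) ≃+ W₂.geomTorsion (p : ℤ))
    (he : ∀ (σ : absoluteGaloisGroup ℚ) (P : W₁.geomTorsion (p : ℤ)), e (σ • P) = σ • e P)
    (heL : ∀ (v : HeightOneSpectrum (𝓞 ℚ)) (hv : ((p : ℕ) : 𝓞 ℚ) ∈ v.asIdeal),
      ∀ P : W₁.geomTorsion (p : ℤ),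
        AddSubgroup.inclusion (W₁.geomTorsion_le_geomPrimaryTorsion p) P ∈ (L₁ v hv).plus ↔
          AddSubgroup.inclusion (W₂.geomTorsion_le_geomPrimaryTorsion p) (e P) ∈ (L₂ v hv).plus) :
    Nat.card (gvSelmerInfty κ (W₁.geomPrimaryTorsion p) L₁ S₀ ⊓
        (subgroupH1 κ.kerSubgroup (W₁.geomPrimaryTorsion p))[(p : ℤ)] :
        AddSubgroup (subgroupH1 κ.kerSubgroup (W₁.geomPrimaryTorsion p))) =
      Nat.card (gvSelmerInfty κ (W₂.geomPrimaryTorsion p) L₂ S₀ ⊓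
        (subgroupH1 κ.kerSubgroup (W₂.geomPrimaryTorsion p))[(p : ℤ)] :
        AddSubgroup (subgroupH1 κ.kerSubgroup (W₂.geomPrimaryTorsion p))) :=
  natCard_gvSelmerInfty_inf_torsion_eq_of_isRamifiedOrdinaryLine_of_torsionIso W₁ W₂ κ L₁ L₂ S₀ hL₁
    hL₂ htors₁ htors₂ hS₁ hS₂
    (RamifiedOrdinaryLineQuotientModelFree.data_gr_invariants_eq_zero_of_isRamifiedOrdinaryLine hp2 κ
      L₁ hL₁)
    (RamifiedOrdinaryLineQuotientModelFree.data_gr_invariants_eq_zero_of_isRamifiedOrdinaryLine hp2 κ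
      L₂ hL₂)
    e he heL

end Summit.BirchSwinnertonDyer.Rank1Residual.Additive

end
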